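import Literature.NumberTheory.LFunctions.PartialEulerProducts
import HarnessLib

/-!
# Partial Euler products: proof of Conrad's Lemma 3.2 (products versus sums of logarithms)

Sibling proof file of `Literature.NumberTheory.LFunctions.PartialEulerProducts` discharging the
named fact `Literature.NumberTheory.LFunctions.PartialEuler.Conrad2005_lemma_3_2` (K. Conrad, *Partial Euler products on the
critical line*, Canad. J. Math. **57** (2005), Lemma 3.2, p. 272): for complex numbers `γ_{p,i}`
in the open unit disc with `max_i |γ_{p,i}| → 0`,
`∏_{p ≤ x} ∏_i (1 - γ_{p,i})⁻¹ ∼ C/(log x)^r` (`C ≠ 0`, `r ∈ ℂ`) iff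
`-∑_{p ≤ x} ∑_i log(1 - γ_{p,i}) = -r log log x + C' + o(1)` for some `C'` with `e^{C'} = C`.

Conrad: "this is a simple extension of the standard fact that the product of a (linearly
ordered) sequence of complex numbers tending to 1 converges if and only if the corresponding
series of principal branch logarithms converges [Ahlfors, pp. 191–192]". The proof written out:
with `Σ(x) = -∑_{p ≤ x} ∑_i log(1 - γ_{p,i})` one has `exp Σ(x) = ∏_{p ≤ x} ∏_i (1 - γ_{p,i})⁻¹`, and
`(log x)^r = exp(r log log x)` for `x > 1`.
(⇐) `∏/(C/(log x)^r) = exp(Σ(x) + r log log x - C') → exp 0 = 1`.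
(⇒) Put `E(x) = Σ(x) + r log log x - log C`; then `exp E(x) → 1`, so `g(x) = log (exp E(x)) → 0`
and `E(x) = g(x) - 2πi k(x)` with `k(x) ∈ ℤ`. The function `E` varies by less than `1` on
`[n, n+1]` for large `n` (its jump at a prime `p` is `-∑_i log(1 - γ_{p,i}) → 0`, its drift is
`r (log log x - log log n) → 0`), and `|g| < 1` eventually, so `k(x) = k(n)` on `[n, n+1]` and `k`
is eventually a constant `k₀`; then `C' = log C - 2πi k₀` works. No definitions are introduced.

## References

* K. Conrad, *Partial Euler products on the critical line*, Canad. J. Math. 57 (2005) 267–297,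
  Lemma 3.2. [cite: Conrad2005PartialEuler]
* L. V. Ahlfors, *Complex Analysis*, 3rd ed., pp. 191–192 (products and sums of logarithms).
-/

noncomputable section

open scoped Topology Real
open Filter Finset Complex Asymptotics

namespace Literature.NumberTheory.LFunctions

namespace PartialEuler

/-! ### Two limits along the integers -/

/-- `log log (n+1) - log log n → 0`: for `n ≥ 3` it lies in `[0, 1/n]`
(`log log(n+1) - log log n = log (1 + (log(n+1) - log n)/log n) ≤ (log(1 + 1/n))/log n ≤ 1/n`).
[folklore] -/
theorem tendsto_loglog_succ_sub_loglog :
    Tendsto (fun n : ℕ => Real.log (Real.log ((n : ℝ) + 1)) - Real.log (Real.log n)) atTop (𝓝 0) := by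
  have hup : ∀ n : ℕ, 3 ≤ n →
      Real.log (Real.log ((n : ℝ) + 1)) - Real.log (Real.log n) ≤ 1 / n := by
    intro n hn
    have hn3 : (3 : ℝ) ≤ n := by exact_mod_cast hn
    have hn0 : (0 : ℝ) < n := by linarith
    have hlogn : 1 < Real.log n := by
      rw [Real.lt_log_iff_exp_lt hn0]
      have := Real.exp_one_lt_d9
      linarith
    have hlogn0 : 0 < Real.log n := by linarith
    have hsucc : Real.log ((n : ℝ) + 1) - Real.log n ≤ 1 / n := by
      rw [← Real.log_div (by linarith) hn0.ne', add_div, div_self hn0.ne']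
      have := Real.log_le_sub_one_of_pos (show 0 < 1 + 1 / (n : ℝ) by positivity)
      linarith
    have hpos : 0 < Real.log ((n : ℝ) + 1) := Real.log_pos (by linarith)
    rw [← Real.log_div hpos.ne' hlogn0.ne']
    have hq : Real.log ((n : ℝ) + 1) / Real.log n = 1 + (Real.log ((n : ℝ) + 1) - Real.log n) / Real.log n := by
      field_simp
      ring
    rw [hq]
    refine (Real.log_le_sub_one_of_pos ?_).trans ?_
    · have : 0 ≤ (Real.log ((n : ℝ) + 1) - Real.log n) / Real.log n :=
        div_nonneg (by linarith [Real.log_le_log hn0 (by linarith : (n : ℝ) ≤ n + 1)]) hlogn0.le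
      linarith
    · rw [add_sub_cancel_left]
      calc (Real.log ((n : ℝ) + 1) - Real.log n) / Real.log n ≤ (1 / n) / Real.log n := by
            gcongr
        _ ≤ (1 / n) / 1 := by
            gcongr
        _ = 1 / n := by rw [div_one]
  have hlow : ∀ n : ℕ, 3 ≤ n → 0 ≤ Real.log (Real.log ((n : ℝ) + 1)) - Real.log (Real.log n) := by
    intro n hn
    have hn3 : (3 : ℝ) ≤ n := by exact_mod_cast hn
    have hlogn0 : 0 < Real.log n := Real.log_pos (by linarith)
    linarith [Real.log_le_log hlogn0 (Real.log_le_log (by linarith) (by linarith : (n : ℝ) ≤ n + 1))]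
  refine tendsto_of_tendsto_of_tendsto_of_le_of_le' tendsto_const_nhds
    tendsto_one_div_atTop_nhds_zero_nat ?_ ?_
  · filter_upwards [eventually_ge_atTop 3] with n hn using hlow n hn
  · filter_upwards [eventually_ge_atTop 3] with n hn using hup n hn

/-- From `∑_i ‖γ_{p,i}‖ → 0` along the primes (cofinite filter on `Nat.Primes`) to the
`ℕ`-indexed statement: `[n prime] ∑_i ‖γ_{n,i}‖ → 0` as `n → ∞`. [folklore] -/
theorem tendsto_ite_prime_of_tendsto_cofinite {d : ℕ} {γ : ℕ → Fin d → ℂ}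
    (hγ0 : Tendsto (fun p : Nat.Primes => ∑ i, ‖γ p i‖) cofinite (𝓝 0)) :
    Tendsto (fun n : ℕ => if n.Prime then ∑ i, ‖γ n i‖ else 0) atTop (𝓝 0) := by
  rw [← Nat.cofinite_eq_atTop]
  intro U hU
  have h0 : (0 : ℝ) ∈ U := mem_of_mem_nhds hU
  have hfin := hγ0 hU
  rw [Filter.mem_map, mem_cofinite] at hfin ⊢
  refine (hfin.image (fun p : Nat.Primes => (p : ℕ))).subset fun n hn => ?_
  simp only [Set.mem_compl_iff, Set.mem_preimage] at hn
  by_cases hp : n.Prime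
  · rw [if_pos hp] at hn
    exact ⟨⟨n, hp⟩, by simpa using hn, rfl⟩
  · rw [if_neg hp] at hn
    exact absurd h0 hn

/-! ### The lemma -/

/-- **Discharge of `Conrad2005_lemma_3_2`** (Conrad 2005, Lemma 3.2; Ahlfors, *Complex
Analysis*, pp. 191–192): products of complex numbers tending to `1` versus sums of their principal
logarithms, with the asymptotic `C/(log x)^r`. See the module docstring for the proof.
[cite: Conrad2005PartialEuler, Lemma 3.2] -/
theorem Conrad2005_lemma_3_2_holds : Conrad2005_lemma_3_2 := by
  intro d hd γ hγ hγ0 C hC r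
  -- notation
  set P : ℝ → ℂ := fun x => ∏ p ∈ Nat.primesLE ⌊x⌋₊, ∏ i, (1 - γ p i)⁻¹ with hP
  set Sg : ℝ → ℂ := fun x => -(∑ p ∈ Nat.primesLE ⌊x⌋₊, ∑ i, log (1 - γ p i)) with hSg
  set V : ℝ → ℂ := fun x => C / ((Real.log x : ℝ) : ℂ) ^ r with hV
  have hne1 : ∀ p : ℕ, p.Prime → ∀ i, 1 - γ p i ≠ 0 := by
    intro p hp i h0
    have := hγ p hp i
    rw [sub_eq_zero] at h0
    rw [← h0, norm_one] at this
    exact lt_irrefl _ this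
  have hexpSg : ∀ x, exp (Sg x) = P x := by
    intro x
    simp only [hSg, hP]
    rw [← Finset.sum_neg_distrib, exp_sum]
    refine Finset.prod_congr rfl fun p hp => ?_
    rw [← Finset.sum_neg_distrib, exp_sum]
    refine Finset.prod_congr rfl fun i _ => ?_
    rw [exp_neg, exp_log (hne1 p (Nat.prime_of_mem_primesLE hp) i)]
  -- `(log x)^r = exp (r log log x)` for `x > 1`
  have hlogpow : ∀ x : ℝ, 1 < x → ((Real.log x : ℝ) : ℂ) ^ r =
      exp (r * ((Real.log (Real.log x) : ℝ) : ℂ)) := by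
    intro x hx
    have hlx : 0 < Real.log x := Real.log_pos hx
    rw [cpow_def_of_ne_zero (by exact_mod_cast hlx.ne'), ← ofReal_log hlx.le, mul_comm]
  have hVne : ∀ᶠ x : ℝ in atTop, V x ≠ 0 := by
    filter_upwards [eventually_gt_atTop 1] with x hx
    simp only [hV]
    rw [hlogpow x hx]
    exact div_ne_zero hC (exp_ne_zero _)
  -- the quotient `P / V` as an exponential
  have hquot : ∀ (C' : ℂ), exp C' = C → ∀ᶠ x : ℝ in atTop,
      (P / V) x = exp (Sg x - (-r * log ((Real.log x : ℝ) : ℂ) + C')) := by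
    intro C' hC'
    filter_upwards [eventually_gt_atTop 1] with x hx
    have hlx : 0 < Real.log x := Real.log_pos hx
    simp only [Pi.div_apply, hV]
    rw [← hexpSg, hlogpow x hx, ← ofReal_log hlx.le, exp_sub, exp_add, hC', exp_neg,
      show -r * ((Real.log (Real.log x) : ℝ) : ℂ) = -(r * ((Real.log (Real.log x) : ℝ) : ℂ)) by ring,
      exp_neg]
    field_simp
  constructor
  · -- (⇒)
    intro hPV
    have hratio : Tendsto (P / V) atTop (𝓝 1) := (isEquivalent_iff_tendsto_one hVne).mp hPV
    set C₀ : ℂ := log C with hC₀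
    have hC₀exp : exp C₀ = C := exp_log hC
    set E : ℝ → ℂ := fun x => Sg x - (-r * log ((Real.log x : ℝ) : ℂ) + C₀) with hE
    have hexpE : Tendsto (fun x => exp (E x)) atTop (𝓝 1) :=
      hratio.congr' (hquot C₀ hC₀exp)
    -- `g = log ∘ exp ∘ E → 0`, and `E = g - 2πi k` with `k` integral
    have hg : Tendsto (fun x => log (exp (E x))) atTop (𝓝 0) := by
      have := ((continuousAt_clog (by simp : (1 : ℂ) ∈ slitPlane)).tendsto.comp hexpE)
      rwa [log_one] at this
    choose k hk using fun x : ℝ => log_exp_exists (E x)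
    -- hk x : log (exp (E x)) = E x + k x * (2πI)
    -- (a) `|g| < 1` eventually
    have hg1 : ∀ᶠ x : ℝ in atTop, ‖log (exp (E x))‖ < 1 := by
      have := hg.eventually (Metric.ball_mem_nhds (0 : ℂ) one_pos)
      filter_upwards [this] with x hx
      simpa using hx
    -- (b) the jumps of `Sg` tend to `0`
    have hjump : Tendsto (fun n : ℕ => ‖Sg ((n : ℝ) + 1) - Sg n‖) atTop (𝓝 0) := by
      have hγn := tendsto_ite_prime_of_tendsto_cofinite hγ0
      -- eventually `∑_i ‖γ_{n+1,i}‖ ≤ 1/2`, then `‖jump‖ ≤ (3/2) ∑ ‖γ‖`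
      have hγn' : Tendsto (fun n : ℕ => if (n + 1).Prime then ∑ i, ‖γ (n + 1) i‖ else 0) atTop (𝓝 0) :=
        hγn.comp (tendsto_add_atTop_nat 1)
      have hsmall : ∀ᶠ n : ℕ in atTop, (if (n + 1).Prime then ∑ i, ‖γ (n + 1) i‖ else 0) < 1 / 2 :=
        (tendsto_order.mp hγn').2 _ one_half_pos
      have hbd : ∀ᶠ n : ℕ in atTop, ‖Sg ((n : ℝ) + 1) - Sg n‖ ≤
          3 / 2 * (if (n + 1).Prime then ∑ i, ‖γ (n + 1) i‖ else 0) := by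
        filter_upwards [hsmall] with n hn
        have hfl : ⌊(n : ℝ) + 1⌋₊ = n + 1 := by exact_mod_cast Nat.floor_natCast (n + 1)
        simp only [hSg, hfl, Nat.floor_natCast, Nat.primesLE_succ]
        by_cases hp : (n + 1).Prime
        · rw [if_pos hp, if_pos hp, Finset.sum_insert (by
            intro h; exact absurd (Nat.le_of_mem_primesLE h) (by omega))]
          rw [if_pos hp] at hn
          have : -(∑ i, log (1 - γ (n + 1) i) + ∑ p ∈ Nat.primesLE n, ∑ i, log (1 - γ p i)) -
              -∑ p ∈ Nat.primesLE n, ∑ i, log (1 - γ p i) = -∑ i, log (1 - γ (n + 1) i) := by ring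
          rw [this, norm_neg]
          refine (norm_sum_le _ _).trans ?_
          rw [Finset.mul_sum]
          refine Finset.sum_le_sum fun i _ => ?_
          have hi : ‖γ (n + 1) i‖ ≤ 1 / 2 := by
            have := Finset.single_le_sum (f := fun i => ‖γ (n + 1) i‖) (fun _ _ => norm_nonneg _)
              (Finset.mem_univ i)
            linarith
          have := norm_log_one_add_half_le_self (z := -γ (n + 1) i) (by rwa [norm_neg])
          rwa [norm_neg, ← sub_eq_add_neg] at this
        · rw [if_neg hp, if_neg hp, sub_self, norm_zero, mul_zero]
      refine squeeze_zero' (Eventually.of_forall fun n => norm_nonneg _) hbd ?_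
      simpa using hγn'.const_mul (3 / 2 : ℝ)
    -- (c) the drift tends to `0`
    have hdrift : Tendsto (fun n : ℕ => ‖r‖ * (Real.log (Real.log ((n : ℝ) + 1)) - Real.log (Real.log n)))
        atTop (𝓝 0) := by
      simpa using tendsto_loglog_succ_sub_loglog.const_mul ‖r‖
    -- (d) hence `‖E x - E n‖ < 1` for `x ∈ [n, n+1]`, `n` large
    have hvar : ∀ᶠ n : ℕ in atTop, ∀ x : ℝ, (n : ℝ) ≤ x → x ≤ n + 1 → ‖E x - E n‖ < 1 := by
      have h1 := (tendsto_order.mp hjump).2 _ one_half_pos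
      have h2 := (tendsto_order.mp hdrift).2 _ one_half_pos
      filter_upwards [h1, h2, eventually_ge_atTop 3] with n hj hdr hn3 x hnx hxn
      have hn3' : (3 : ℝ) ≤ n := by exact_mod_cast hn3
      have hx1 : 1 < x := by linarith
      have hlx : 0 < Real.log x := Real.log_pos hx1
      have hln : 0 < Real.log n := Real.log_pos (by linarith)
      -- `Sg x ∈ {Sg n, Sg (n+1)}`
      have hSgx : Sg x = Sg n ∨ Sg x = Sg ((n : ℝ) + 1) := by
        rcases lt_or_eq_of_le hxn with hlt | heq
        · left
          simp only [hSg]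
          rw [show ⌊x⌋₊ = n from (Nat.floor_eq_iff (by linarith)).mpr ⟨hnx, hlt⟩, Nat.floor_natCast]
        · right; rw [heq]
      -- the drift
      have hdx : ‖-r * log ((Real.log x : ℝ) : ℂ) - -r * log ((Real.log n : ℝ) : ℂ)‖ ≤
          ‖r‖ * (Real.log (Real.log ((n : ℝ) + 1)) - Real.log (Real.log n)) := by
        have hmono1 : Real.log (Real.log n) ≤ Real.log (Real.log x) :=
          Real.log_le_log hln (Real.log_le_log (by linarith) hnx)
        have hmono2 : Real.log (Real.log x) ≤ Real.log (Real.log ((n : ℝ) + 1)) :=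
          Real.log_le_log hlx (Real.log_le_log (by linarith) hxn)
        have heq : -r * log ((Real.log x : ℝ) : ℂ) - -r * log ((Real.log n : ℝ) : ℂ) =
            -r * (((Real.log (Real.log x) - Real.log (Real.log n) : ℝ)) : ℂ) := by
          rw [← ofReal_log hlx.le, ← ofReal_log hln.le]
          push_cast
          ring
        rw [heq, norm_mul, norm_neg, norm_real, Real.norm_eq_abs, abs_of_nonneg (by linarith)]
        exact mul_le_mul_of_nonneg_left (by linarith) (norm_nonneg r)
      have hE' : E x - E n = (Sg x - Sg n) + (-(-r * log ((Real.log x : ℝ) : ℂ) - -r * log ((Real.log n : ℝ) : ℂ))) := by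
        simp only [hE]; ring
      rw [hE']
      refine (norm_add_le _ _).trans_lt ?_
      rw [norm_neg]
      rcases hSgx with h0 | h0
      · rw [h0, sub_self, norm_zero, zero_add]
        linarith
      · rw [h0]
        linarith
    -- (e) `k` is constant on `[n, n+1]` for `n` large, hence eventually constant
    have hkloc : ∀ᶠ n : ℕ in atTop, ∀ x : ℝ, (n : ℝ) ≤ x → x ≤ n + 1 → k x = k n := by
      have hg1n : ∀ᶠ n : ℕ in atTop, ∀ x : ℝ, (n : ℝ) ≤ x → ‖log (exp (E x))‖ < 1 := by
        obtain ⟨X, hX⟩ := eventually_atTop.mp hg1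
        filter_upwards [eventually_ge_atTop ⌈X⌉₊] with n hn x hx
        exact hX x ((Nat.le_ceil X).trans ((by exact_mod_cast hn : (⌈X⌉₊ : ℝ) ≤ n).trans hx))
      filter_upwards [hvar, hg1n] with n hv hgn x hnx hxn
      have h1 := hv x hnx hxn
      have h2 := hgn x hnx
      have h3 := hgn n le_rfl
      -- `2πi (k x - k n) = (g x - g n) - (E x - E n)`
      have hkx := hk x
      have hkn := hk n
      have hdiff : ((k x - k n : ℤ) : ℂ) * (2 * π * I) =
          (log (exp (E x)) - log (exp (E n))) - (E x - E n) := by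
        push_cast
        linear_combination hkn - hkx
      have hnorm : ‖((k x - k n : ℤ) : ℂ) * (2 * π * I)‖ < 3 := by
        rw [hdiff]
        refine (norm_sub_le _ _).trans_lt ?_
        have := norm_sub_le (log (exp (E x))) (log (exp (E n)))
        linarith
      rw [norm_mul, show ‖(2 * π * I : ℂ)‖ = 2 * π by simp [Real.pi_pos.le], norm_intCast] at hnorm
      have hlt : |((k x - k n : ℤ) : ℝ)| < 1 := by
        by_contra hge
        push Not at hge
        have : (1 : ℝ) * (2 * π) ≤ |((k x - k n : ℤ) : ℝ)| * (2 * π) := by gcongr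
        linarith [Real.two_le_pi]
      have : k x - k n = 0 := by
        have h := Int.abs_lt_one_iff.mp (by exact_mod_cast hlt)
        exact h
      omega
    obtain ⟨N, hN⟩ := eventually_atTop.mp hkloc
    have hkconst : ∀ n : ℕ, N ≤ n → k n = k N := by
      intro n hn
      induction n, hn using Nat.le_induction with
      | base => rfl
      | succ m hm ih =>
        rw [← ih]
        have := hN m hm ((m : ℝ) + 1) (by linarith) le_rfl
        push_cast
        exact this
    have hkx : ∀ x : ℝ, (N : ℝ) ≤ x → k x = k N := by
      intro x hx
      have hfl : N ≤ ⌊x⌋₊ := Nat.le_floor hx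
      rw [← hkconst ⌊x⌋₊ hfl]
      exact hN ⌊x⌋₊ hfl x (Nat.floor_le (by linarith [(Nat.cast_nonneg N : (0 : ℝ) ≤ N)]))
        (Nat.lt_floor_add_one x).le
    -- conclude with `C' = C₀ - 2πi k N`
    refine ⟨C₀ - (k N : ℂ) * (2 * π * I), ?_, ?_⟩
    · rw [exp_sub, hC₀exp, exp_int_mul_two_pi_mul_I, div_one]
    · refine hg.congr' ?_
      filter_upwards [eventually_ge_atTop (N : ℝ)] with x hx
      rw [hk x, hkx x hx]
      simp only [hE]
      ring
  · -- (⇐)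
    rintro ⟨C', hC', hT⟩
    rw [isEquivalent_iff_tendsto_one hVne]
    have h := ((continuous_exp.tendsto (0 : ℂ)).comp hT)
    rw [exp_zero] at h
    exact h.congr' ((hquot C' hC').mono fun x hx => hx.symm)

end PartialEuler

end Literature.NumberTheory.LFunctions

end
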